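import Mathlib
import Literature.Analysis.Approximation.KernelAbsorption
import Literature.Analysis.PDE.NearInverseSquareFarExact
import Literature.Analysis.PDE.NearInverseSquareFarLadderData
import Literature.Analysis.PDE.Wave1DFarLincomb

/-!
# Kernel absorption for the far channel estimate: the reduced energy modulo the TRUE kernel

Analysis/PDE support file (everything proved). Fix `n`, the smooth `ι = 1/x` on `[½,∞)` with smooth
primitive, and let `c₀(n)` be the exact channel constant. For `0 < ε ≤ min(¼, c₀/9216)`, a continuous
`W ≥ 0` with `|W − n(n+1)/x²| ≤ ε x^{−5/2}` (`x ≥ ½`), and a finite family `B_0,…,B_{M−1}` of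
NON-RADIATING far solutions (global `C²`, residual `0` on `{x ≥ 1}`, finite `W`-energy, far energy
`→ 0` at `±∞`) whose data approximate the exact kernel data in the sense

  (happroxK) for all Taylor coefficients `ch, cg` and `ε' > 0` there is `c` with
  `N_W(P_ch − Σ c_m B_m(0,·), Q_cg − Σ c_m ∂ₜB_m(0,·)) ≤ ½ N_W(P_ch, Q_cg) + ε'`
  (`P_ch, Q_cg` the Darboux ladders of the Taylor sums, `N_W` the `W`-energy norm on `(1,∞)`),

every far solution `ψ` satisfies, for every `ε' > 0` and some coefficients `c`,

  `∫_{x>1} e_W[ψ − Σ c_m B_m](0,·) ≤ (144/c₀)·(L⁺[ψ] + L⁻[ψ]) + ε'`        (`farUnit_absorb`).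

This is `Literature.Analysis.Approximation.kernel_absorption` instantiated with: `X` = the real vector
space of far solutions, `dat ψ = (ψ(0,·), ∂ₜψ(0,·))`, `N_W`, `Adm` = `C¹ × C⁰` data with integrable
energy pieces, `Λ = L⁺ + L⁻` (`limUnder`s of the far energies; subtracting a non-radiating solution does
not increase it, `Wave1DFarSolutionSpace`/`Wave1DFarLincomb`), `K` = combinations of the `B_m`,
`D₀` = ladder-Taylor data (`hexact` = `NearInverseSquareFarExact.farUnit_exact_modulo_kernel`).
Route PhotonSphereChannels, `FixedModeChannels`, far side (stmt-FinalStateConjecture-10048).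
-/

noncomputable section

namespace Literature.Analysis.PDE

open Set Filter MeasureTheory Finset Literature.Analysis.ODE Literature.Analysis.Approximation
  Literature.Analysis.Calculus
open scoped _root_.Topology

variable {ι : ℝ → ℝ}

/-! ### The absorption statement -/

/-- **The reduced energy modulo the TRUE kernel** (kernel absorption instantiated). See the module
docstring. [folklore] -/
theorem farUnit_absorb (hι : ContDiff ℝ (⊤ : ℕ∞) ι)
    (hιeq : ∀ x : ℝ, 1 / 2 ≤ x → ι x = x⁻¹) {I : ℝ → ℝ} (hI : ContDiff ℝ (⊤ : ℕ∞) I)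
    (hI' : ∀ x, HasDerivAt I (ι x) x) (n : ℕ) :
    ∃ c₀ : ℝ, 0 < c₀ ∧ ∀ (ε : ℝ), 0 < ε → ε ≤ min (1 / 4) (c₀ / 9216) → ∀ (W : ℝ → ℝ),
      Continuous W → (∀ x, 0 ≤ W x) →
      (∀ x : ℝ, 1 / 2 ≤ x → |W x - (n : ℝ) * ((n : ℝ) + 1) / x ^ 2| ≤ ε * x ^ (-(5 : ℝ) / 2)) →
      ∀ (M : ℕ) (B : Fin M → ℝ → ℝ → ℝ), (∀ m, ContDiff ℝ 2 (Function.uncurry (B m))) →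
      (∀ m t x, 1 ≤ x →
        iteratedDeriv 2 (fun τ => B m τ x) t - iteratedDeriv 2 (B m t) x + W x * B m t x = 0) →
      (∀ m, IntegrableOn (fun x => deriv (fun τ => B m τ x) 0 ^ 2 + deriv (B m 0) x ^ 2
        + W x * B m 0 x ^ 2) (Ioi 1)) →
      (∀ m, Tendsto (fun t => ∫ x in Ioi (1 + |t|), (deriv (fun τ => B m τ x) t ^ 2
        + deriv (B m t) x ^ 2 + W x * B m t x ^ 2)) atTop (𝓝 0)) →
      (∀ m, Tendsto (fun t => ∫ x in Ioi (1 + |t|), (deriv (fun τ => B m τ x) t ^ 2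
        + deriv (B m t) x ^ 2 + W x * B m t x ^ 2)) atBot (𝓝 0)) →
      -- (happroxK): the true kernel data approximate the exact kernel data
      (∀ (ch cg : ℕ → ℝ) (ε' : ℝ), 0 < ε' → ∃ c : Fin M → ℝ,
        Real.sqrt (∫ x in Ioi 1,
          (deriv (fun y => ladder ι n (fun z => ∑ m ∈ Finset.range (n + 1),
              ch m / m.factorial * (z - 1) ^ m) y - ∑ m, c m * B m 0 y) x ^ 2
          + W x * (ladder ι n (fun z => ∑ m ∈ Finset.range (n + 1),
              ch m / m.factorial * (z - 1) ^ m) x - ∑ m, c m * B m 0 x) ^ 2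
          + (ladder ι n (fun z => ∑ m ∈ Finset.range n, cg m / m.factorial * (z - 1) ^ m) x
              - ∑ m, c m * deriv (fun τ => B m τ x) 0) ^ 2))
        ≤ (1 / 2) * Real.sqrt (∫ x in Ioi 1,
          (deriv (ladder ι n (fun z => ∑ m ∈ Finset.range (n + 1),
              ch m / m.factorial * (z - 1) ^ m)) x ^ 2
          + W x * (ladder ι n (fun z => ∑ m ∈ Finset.range (n + 1),
              ch m / m.factorial * (z - 1) ^ m) x) ^ 2
          + (ladder ι n (fun z => ∑ m ∈ Finset.range n, cg m / m.factorial * (z - 1) ^ m) x) ^ 2))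
          + ε') →
      ∀ (ψ : ℝ → ℝ → ℝ), ContDiff ℝ 2 (Function.uncurry ψ) →
      (∀ t x, 1 ≤ x →
        iteratedDeriv 2 (fun τ => ψ τ x) t - iteratedDeriv 2 (ψ t) x + W x * ψ t x = 0) →
      IntegrableOn (fun x => deriv (fun τ => ψ τ x) 0 ^ 2 + deriv (ψ 0) x ^ 2
        + W x * ψ 0 x ^ 2) (Ioi 1) →
      ∀ ε' : ℝ, 0 < ε' → ∃ c : Fin M → ℝ,
        IntegrableOn (fun x => deriv (fun τ => ψ τ x - ∑ m, c m * B m τ x) 0 ^ 2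
          + deriv (fun y => ψ 0 y - ∑ m, c m * B m 0 y) x ^ 2
          + W x * (ψ 0 x - ∑ m, c m * B m 0 x) ^ 2) (Ioi 1) ∧
        ∫ x in Ioi 1, (deriv (fun τ => ψ τ x - ∑ m, c m * B m τ x) 0 ^ 2
          + deriv (fun y => ψ 0 y - ∑ m, c m * B m 0 y) x ^ 2
          + W x * (ψ 0 x - ∑ m, c m * B m 0 x) ^ 2)
        ≤ (144 / c₀) * (limUnder atTop (fun t => ∫ x in Ioi (1 + |t|),
              (deriv (fun τ => ψ τ x) t ^ 2 + deriv (ψ t) x ^ 2 + W x * ψ t x ^ 2))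
            + limUnder atBot (fun t => ∫ x in Ioi (1 + |t|),
              (deriv (fun τ => ψ τ x) t ^ 2 + deriv (ψ t) x ^ 2 + W x * ψ t x ^ 2))) + ε' := by
  obtain ⟨c₀, hc₀, hexact0⟩ := farUnit_exact_modulo_kernel hι hιeq hI hI' n
  refine ⟨c₀, hc₀, ?_⟩
  intro ε hε hεle W hW hW0 hclose M B hB hresB hintB hradT hradB happroxK ψ hψ hres hint ε' hε'
  have hε4 : ε ≤ 1 / 4 := hεle.trans (min_le_left _ _)
  have hεc : ε ≤ c₀ / 9216 := hεle.trans (min_le_right _ _)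
  have hpt := fun x (hx : (1 : ℝ) ≤ x) => nearInverseSquare_pointwise (n := n) hε.le hε4 hW0 hclose hx
  have hWle : ∀ x, 1 ≤ x → W x ≤ ((n : ℝ) * (n + 1) + 1) * ι x ^ 2 := by
    intro x hx
    have h3 := (hpt x hx).2.2.1
    rw [hιeq x (by linarith), inv_pow]
    have : ε * (x ^ 2)⁻¹ ≤ 1 * (x ^ 2)⁻¹ := mul_le_mul_of_nonneg_right (by linarith) (by positivity)
    rw [div_eq_mul_inv] at h3
    nlinarith [h3, this]
  ------------------------------------------------------------------
  -- the objects of the abstract lemma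
  ------------------------------------------------------------------
  -- far solutions form a real vector space
  let good : (ℝ → ℝ → ℝ) → Prop := fun φ => ContDiff ℝ 2 (Function.uncurry φ) ∧
    (∀ t x, 1 ≤ x →
      iteratedDeriv 2 (fun τ => φ τ x) t - iteratedDeriv 2 (φ t) x + W x * φ t x = 0) ∧
    IntegrableOn (fun x => deriv (fun τ => φ τ x) 0 ^ 2 + deriv (φ 0) x ^ 2
      + W x * φ 0 x ^ 2) (Ioi 1)
  have good_add : ∀ φ₁ φ₂, good φ₁ → good φ₂ → good (φ₁ + φ₂) := fun φ₁ φ₂ h₁ h₂ => by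
    change good (fun t x => φ₁ t x + φ₂ t x)
    exact farSol_add hW hW0 h₁.1 h₁.2.1 h₁.2.2 h₂.1 h₂.2.1 h₂.2.2
  have good_smul : ∀ (c : ℝ) φ, good φ → good (c • φ) := fun c φ h => by
    change good (fun t x => c * φ t x)
    exact farSol_smul (W := W) h.1 h.2.1 h.2.2 c
  have good_zero : good 0 := by
    change good (fun _ _ => (0 : ℝ))
    refine ⟨contDiff_const, fun t x _ => by simp, ?_⟩
    simp
  let Xs : Submodule ℝ (ℝ → ℝ → ℝ) :=
    { carrier := {φ | good φ}
      add_mem' := fun {φ₁ φ₂} h₁ h₂ => good_add φ₁ φ₂ h₁ h₂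
      zero_mem' := good_zero
      smul_mem' := fun c {φ} h => good_smul c φ h }
  have hXmem : ∀ {φ : ℝ → ℝ → ℝ}, φ ∈ Xs ↔ good φ := fun {φ} => Iff.rfl
  ------------------------------------------------------------------
  -- data map, admissible data, the energy norm
  ------------------------------------------------------------------
  let X : Type := ↥Xs
  let D : Type := (ℝ → ℝ) × (ℝ → ℝ)
  have hslice_diff : ∀ φ : X, ∀ x, DifferentiableAt ℝ (fun τ => (φ : ℝ → ℝ → ℝ) τ x) 0 := fun φ x =>
    (((hXmem.1 φ.2).1.comp (contDiff_id.prodMk contDiff_const)).differentiable (by norm_num)) 0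
  let dat : X →+ D :=
    { toFun := fun φ => ((φ : ℝ → ℝ → ℝ) 0, fun x => deriv (fun τ => (φ : ℝ → ℝ → ℝ) τ x) 0)
      map_zero' := by
        ext x
        · rfl
        · show deriv (fun τ => ((0 : X) : ℝ → ℝ → ℝ) τ x) 0 = 0
          simp
      map_add' := fun φ₁ φ₂ => by
        ext x
        · rfl
        · show deriv (fun τ => ((φ₁ + φ₂ : X) : ℝ → ℝ → ℝ) τ x) 0
            = deriv (fun τ => (φ₁ : ℝ → ℝ → ℝ) τ x) 0 + deriv (fun τ => (φ₂ : ℝ → ℝ → ℝ) τ x) 0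
          rw [← deriv_fun_add (hslice_diff φ₁ x) (hslice_diff φ₂ x)]
          rfl }
  have hdat_apply : ∀ φ : X, dat φ
      = ((φ : ℝ → ℝ → ℝ) 0, fun x => deriv (fun τ => (φ : ℝ → ℝ → ℝ) τ x) 0) := fun φ => rfl
  -- admissible data
  let adm : D → Prop := fun d => ContDiff ℝ 1 d.1 ∧ Continuous d.2 ∧
    IntegrableOn (fun x => deriv d.1 x ^ 2) (Ioi 1) ∧ IntegrableOn (fun x => W x * d.1 x ^ 2) (Ioi 1) ∧
    IntegrableOn (fun x => d.2 x ^ 2) (Ioi 1)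
  have hsW : Continuous fun x => Real.sqrt (W x) := Real.continuous_sqrt.comp hW
  have hsq : ∀ x, Real.sqrt (W x) ^ 2 = W x := fun x => Real.sq_sqrt (hW0 x)
  have adm_add : ∀ d₁ d₂, adm d₁ → adm d₂ → adm (d₁ + d₂) := by
    rintro ⟨h₁, g₁⟩ ⟨h₂, g₂⟩ ⟨a1, a2, a3, a4, a5⟩ ⟨b1, b2, b3, b4, b5⟩
    refine ⟨a1.add b1, a2.add b2, ?_, ?_, ?_⟩
    · have e : (fun x => deriv (h₁ + h₂) x ^ 2) = fun x => (deriv h₁ x + deriv h₂ x) ^ 2 := by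
        funext x
        rw [show h₁ + h₂ = fun y => h₁ y + h₂ y from rfl,
          deriv_fun_add ((a1.differentiable one_ne_zero) x) ((b1.differentiable one_ne_zero) x)]
      show IntegrableOn (fun x => deriv (h₁ + h₂) x ^ 2) (Ioi 1)
      rw [e]
      exact integrableOn_add_sq (a1.continuous_deriv le_rfl) (b1.continuous_deriv le_rfl) a3 b3
    · show IntegrableOn (fun x => W x * (h₁ x + h₂ x) ^ 2) (Ioi 1)
      have e : (fun x => W x * (h₁ x + h₂ x) ^ 2)
          = fun x => (Real.sqrt (W x) * h₁ x + Real.sqrt (W x) * h₂ x) ^ 2 := by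
        funext x; rw [← mul_add, mul_pow, hsq]
      rw [e]
      have i1 : IntegrableOn (fun x => (Real.sqrt (W x) * h₁ x) ^ 2) (Ioi 1) := by
        refine a4.congr_fun (fun x _ => ?_) measurableSet_Ioi; rw [mul_pow, hsq]
      have i2 : IntegrableOn (fun x => (Real.sqrt (W x) * h₂ x) ^ 2) (Ioi 1) := by
        refine b4.congr_fun (fun x _ => ?_) measurableSet_Ioi; rw [mul_pow, hsq]
      exact integrableOn_add_sq (hsW.mul a1.continuous) (hsW.mul b1.continuous) i1 i2
    · show IntegrableOn (fun x => (g₁ x + g₂ x) ^ 2) (Ioi 1)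
      exact integrableOn_add_sq a2 b2 a5 b5
  have adm_neg : ∀ d, adm d → adm (-d) := by
    rintro ⟨h, g⟩ ⟨a1, a2, a3, a4, a5⟩
    refine ⟨a1.neg, a2.neg, ?_, ?_, ?_⟩
    · show IntegrableOn (fun x => deriv (-h) x ^ 2) (Ioi 1)
      refine a3.congr_fun (fun x _ => ?_) measurableSet_Ioi
      rw [deriv.neg, neg_sq]
    · show IntegrableOn (fun x => W x * (-h x) ^ 2) (Ioi 1)
      refine a4.congr_fun (fun x _ => ?_) measurableSet_Ioi; rw [neg_sq]
    · show IntegrableOn (fun x => (-g x) ^ 2) (Ioi 1)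
      refine a5.congr_fun (fun x _ => ?_) measurableSet_Ioi; rw [neg_sq]
  have adm_zero : adm 0 := by
    refine ⟨contDiff_const, continuous_const, ?_, ?_, ?_⟩ <;> simp
  let Adm : AddSubgroup D :=
    { carrier := {d | adm d}
      add_mem' := fun {d₁ d₂} h₁ h₂ => adm_add d₁ d₂ h₁ h₂
      zero_mem' := adm_zero
      neg_mem' := fun {d} h => adm_neg d h }
  have hAdm : ∀ {d : D}, d ∈ Adm ↔ adm d := fun {d} => Iff.rfl
  -- the energy norm
  let N : D → ℝ := fun d => Real.sqrt (∫ x in Ioi 1, (deriv d.1 x ^ 2 + W x * d.1 x ^ 2 + d.2 x ^ 2))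
  have hN0 : ∀ d, 0 ≤ N d := fun d => Real.sqrt_nonneg _
  have hNneg : ∀ d ∈ Adm, N (-d) = N d := by
    rintro ⟨h, g⟩ -
    show Real.sqrt (∫ x in Ioi 1, (deriv (-h) x ^ 2 + W x * (-h x) ^ 2 + (-g x) ^ 2))
      = Real.sqrt (∫ x in Ioi 1, (deriv h x ^ 2 + W x * h x ^ 2 + g x ^ 2))
    congr 1
    refine setIntegral_congr_fun measurableSet_Ioi fun x _ => ?_
    rw [deriv.neg, neg_sq, neg_sq, neg_sq]
  have hNadd : ∀ d₁ ∈ Adm, ∀ d₂ ∈ Adm, N (d₁ + d₂) ≤ N d₁ + N d₂ := by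
    rintro ⟨h₁, g₁⟩ ha ⟨h₂, g₂⟩ hb
    obtain ⟨a1, a2, a3, a4, a5⟩ := (hAdm.1 ha)
    obtain ⟨b1, b2, b3, b4, b5⟩ := (hAdm.1 hb)
    have h := (sqrt_energy_add_le hW hW0 a1 b1 a2 b2 measurableSet_Ioi a3 a4 a5 b3 b4 b5).2
    show Real.sqrt (∫ x in Ioi 1, (deriv (h₁ + h₂) x ^ 2 + W x * (h₁ x + h₂ x) ^ 2 + (g₁ x + g₂ x) ^ 2))
      ≤ Real.sqrt (∫ x in Ioi 1, (deriv h₁ x ^ 2 + W x * h₁ x ^ 2 + g₁ x ^ 2))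
        + Real.sqrt (∫ x in Ioi 1, (deriv h₂ x ^ 2 + W x * h₂ x ^ 2 + g₂ x ^ 2))
    rw [show h₁ + h₂ = fun y => h₁ y + h₂ y from rfl]
    exact h
  -- data of far solutions are admissible
  have hdat : ∀ φ : X, dat φ ∈ Adm := by
    intro φ
    obtain ⟨hC, -, hI⟩ := hXmem.1 φ.2
    obtain ⟨hgc, hg1, i1, i2, i3⟩ := farEnergy_pieces hW hW0 hC 0 (S := Ioi 1)
      (by simpa only [abs_zero, add_zero] using hI)
    exact ⟨(hC.comp (contDiff_const.prodMk contDiff_id)).of_le (by norm_num), hgc, i1, i2, i3⟩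
  ------------------------------------------------------------------
  -- the exact kernel data `D₀`, the true kernel `K`, the channel functional `Λ`
  ------------------------------------------------------------------
  let D₀ : Set D := {d | ∃ ch cg : ℕ → ℝ,
    d = (ladder ι n (fun z => ∑ m ∈ Finset.range (n + 1), ch m / m.factorial * (z - 1) ^ m),
      ladder ι n (fun z => ∑ m ∈ Finset.range n, cg m / m.factorial * (z - 1) ^ m))}
  have hD₀ : D₀ ⊆ Adm := by
    rintro d ⟨ch, cg, rfl⟩
    obtain ⟨h1, h2, h3, h4, h5⟩ := ladderTaylor_admissible hι hιeq n hW hW0 hWle ch cg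
    exact ⟨h1, h2, h3, h4, h5⟩
  -- combinations of the true kernel elements
  let comb : (Fin M → ℝ) → ℝ → ℝ → ℝ := fun c t x => ∑ m, c m * B m t x
  have comb_good : ∀ c, good (comb c) := fun c => farSol_lincomb hW hW0 hB hresB hintB c
  let Kset : Set X := {k | ∃ c : Fin M → ℝ, (k : ℝ → ℝ → ℝ) = comb c}
  let K : AddSubgroup X :=
    { carrier := Kset
      zero_mem' := ⟨0, by funext t x; simp [comb]⟩
      add_mem' := by
        rintro k₁ k₂ ⟨c₁, hc₁⟩ ⟨c₂, hc₂⟩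
        refine ⟨c₁ + c₂, ?_⟩
        show ((k₁ : ℝ → ℝ → ℝ) + (k₂ : ℝ → ℝ → ℝ)) = comb (c₁ + c₂)
        rw [hc₁, hc₂]
        funext t x
        simp only [comb, Pi.add_apply, ← Finset.sum_add_distrib]
        exact Finset.sum_congr rfl fun m _ => by ring
      neg_mem' := by
        rintro k ⟨c, hc⟩
        refine ⟨-c, ?_⟩
        show -(k : ℝ → ℝ → ℝ) = comb (-c)
        rw [hc]
        funext t x
        simp only [comb, Pi.neg_apply, ← Finset.sum_neg_distrib]
        exact Finset.sum_congr rfl fun m _ => by ring }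
  have hKmem : ∀ {k : X}, k ∈ K ↔ ∃ c : Fin M → ℝ, (k : ℝ → ℝ → ℝ) = comb c := fun {k} => Iff.rfl
  -- the channel functional
  let farE : (ℝ → ℝ → ℝ) → ℝ → ℝ := fun φ t => ∫ x in Ioi (1 + |t|),
    (deriv (fun τ => φ τ x) t ^ 2 + deriv (φ t) x ^ 2 + W x * φ t x ^ 2)
  let Λ : X → ℝ := fun φ => limUnder atTop (farE φ) + limUnder atBot (farE φ)
  have hΛ0 : ∀ φ : X, 0 ≤ Λ φ := by
    intro φ
    obtain ⟨hC, hR, hI⟩ := hXmem.1 φ.2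
    obtain ⟨-, -, -, -, hp, hm⟩ := farSol_energy hW hW0 hC hR hI
    exact add_nonneg hp hm
  -- subtracting a true kernel combination does not increase `Λ`
  have hΛK : ∀ φ : X, ∀ k ∈ K, Λ (φ - k) ≤ Λ φ := by
    intro φ k hk
    obtain ⟨c, hc⟩ := hKmem.1 hk
    obtain ⟨hC, hR, hI⟩ := hXmem.1 φ.2
    obtain ⟨-, hEφ, hTφp, hTφm, -, -⟩ := farSol_energy hW hW0 hC hR hI
    -- `−k` as a non-radiating combination
    obtain ⟨nC, nR, nI⟩ := comb_good (-c)
    obtain ⟨-, hEn, -, -, -, -⟩ := farSol_energy hW hW0 nC nR nI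
    have hradn : ∀ (l : Filter ℝ) [l.NeBot], (∀ m, Tendsto (farE (B m)) l (𝓝 0)) →
        Tendsto (farE (comb (-c))) l (𝓝 0) := fun l _ hl =>
      farEnergy_lincomb_tendsto_zero hW hW0 hB hresB hintB hl (-c) Finset.univ (comb (-c)) rfl
    -- `φ − k` as a far solution, written as `φ + comb(−c)`
    have hdiff : ((φ - k : X) : ℝ → ℝ → ℝ) = fun t x => (φ : ℝ → ℝ → ℝ) t x + comb (-c) t x := by
      rw [Submodule.coe_sub, hc]
      funext t x
      simp only [comb, Pi.sub_apply, Pi.neg_apply, neg_mul, Finset.sum_neg_distrib]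
      ring
    obtain ⟨dC, dR, dI⟩ := hXmem.1 (φ - k).2
    obtain ⟨-, -, hTdp, hTdm, -, -⟩ := farSol_energy hW hW0 dC dR dI
    have hTdp' : Tendsto (farE fun t x => (φ : ℝ → ℝ → ℝ) t x + comb (-c) t x) atTop
        (𝓝 (limUnder atTop (farE ((φ - k : X) : ℝ → ℝ → ℝ)))) := by rw [← hdiff]; exact hTdp
    have hTdm' : Tendsto (farE fun t x => (φ : ℝ → ℝ → ℝ) t x + comb (-c) t x) atBot
        (𝓝 (limUnder atBot (farE ((φ - k : X) : ℝ → ℝ → ℝ)))) := by rw [← hdiff]; exact hTdm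
    have htop := farLimit_add_nonradiating_le hW hW0 hC nC (fun t => (hEφ t).1) (fun t => (hEn t).1)
      hTφp (hradn atTop hradT) hTdp'
    have hbot := farLimit_add_nonradiating_le hW hW0 hC nC (fun t => (hEφ t).1) (fun t => (hEn t).1)
      hTφm (hradn atBot hradB) hTdm'
    exact add_le_add htop hbot
  ------------------------------------------------------------------
  -- `hexact` and `happrox`
  ------------------------------------------------------------------
  have hCst0 : (0 : ℝ) ≤ 8 / c₀ := by positivity
  have hη0 : (0 : ℝ) ≤ 512 * ε / c₀ := by positivity
  have hη18 : 512 * ε / c₀ ≤ 1 / 18 := by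
    rw [div_le_iff₀ hc₀]; linarith
  have hexact : ∀ φ : X, ∀ δ > (0 : ℝ), ∃ k₀ ∈ D₀,
      N (dat φ - k₀) ^ 2 ≤ (8 / c₀) * Λ φ + (512 * ε / c₀) * N (dat φ) ^ 2 + δ := by
    intro φ δ hδ
    obtain ⟨hC, hR, hI⟩ := hXmem.1 φ.2
    obtain ⟨ch, cg, hintd, hle⟩ := hexact0 ε hε hε4 W hW hW0 hclose _ hC hR hI δ hδ
    refine ⟨_, ⟨ch, cg, rfl⟩, ?_⟩
    -- `N(dat φ − k₀)² = ∫ dens`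
    have hdens0 : ∀ x, 0 ≤ deriv (fun y => (φ : ℝ → ℝ → ℝ) 0 y - ladder ι n (fun z =>
        ∑ m ∈ Finset.range (n + 1), ch m / m.factorial * (z - 1) ^ m) y) x ^ 2
        + W x * ((φ : ℝ → ℝ → ℝ) 0 x - ladder ι n (fun z => ∑ m ∈ Finset.range (n + 1),
          ch m / m.factorial * (z - 1) ^ m) x) ^ 2
        + (deriv (fun τ => (φ : ℝ → ℝ → ℝ) τ x) 0 - ladder ι n (fun z => ∑ m ∈ Finset.range n,
          cg m / m.factorial * (z - 1) ^ m) x) ^ 2 := fun x => by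
      have := hW0 x; positivity
    set P : ℝ → ℝ := ladder ι n (fun z => ∑ m ∈ Finset.range (n + 1),
      ch m / m.factorial * (z - 1) ^ m) with hP
    set Q : ℝ → ℝ := ladder ι n (fun z => ∑ m ∈ Finset.range n, cg m / m.factorial * (z - 1) ^ m)
      with hQ
    have e1 : N (dat φ - (P, Q)) ^ 2
        = ∫ x in Ioi 1, (deriv (fun y => (φ : ℝ → ℝ → ℝ) 0 y - P y) x ^ 2
          + W x * ((φ : ℝ → ℝ → ℝ) 0 x - P x) ^ 2
          + (deriv (fun τ => (φ : ℝ → ℝ → ℝ) τ x) 0 - Q x) ^ 2) := by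
      show Real.sqrt (∫ x in Ioi 1, (deriv (fun y => (φ : ℝ → ℝ → ℝ) 0 y - P y) x ^ 2
          + W x * ((φ : ℝ → ℝ → ℝ) 0 x - P x) ^ 2
          + (deriv (fun τ => (φ : ℝ → ℝ → ℝ) τ x) 0 - Q x) ^ 2)) ^ 2 = _
      rw [Real.sq_sqrt (setIntegral_nonneg measurableSet_Ioi fun x _ => hdens0 x)]
    have e2 : N (dat φ) ^ 2 = ∫ x in Ioi 1, (deriv (fun τ => (φ : ℝ → ℝ → ℝ) τ x) 0 ^ 2
        + deriv ((φ : ℝ → ℝ → ℝ) 0) x ^ 2 + W x * (φ : ℝ → ℝ → ℝ) 0 x ^ 2) := by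
      show Real.sqrt (∫ x in Ioi 1, (deriv ((φ : ℝ → ℝ → ℝ) 0) x ^ 2
          + W x * (φ : ℝ → ℝ → ℝ) 0 x ^ 2 + deriv (fun τ => (φ : ℝ → ℝ → ℝ) τ x) 0 ^ 2)) ^ 2 = _
      rw [Real.sq_sqrt (setIntegral_nonneg measurableSet_Ioi fun x _ => by have := hW0 x; positivity)]
      exact setIntegral_congr_fun measurableSet_Ioi fun x _ => by ring
    calc N (dat φ - (P, Q)) ^ 2 = _ := e1
      _ ≤ _ := hle
      _ = (8 / c₀) * Λ φ + (512 * ε / c₀) * N (dat φ) ^ 2 + δ := by rw [e2]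
  have happrox : ∀ k₀ ∈ D₀, ∀ δ > (0 : ℝ), ∃ k ∈ K, N (k₀ - dat k) ≤ (1 / 2) * N k₀ + δ := by
    rintro k₀ ⟨ch, cg, rfl⟩ δ hδ
    obtain ⟨c, hc⟩ := happroxK ch cg δ hδ
    let kf : X := ⟨comb c, (hXmem (φ := comb c)).2 (comb_good c)⟩
    refine ⟨kf, ⟨c, rfl⟩, ?_⟩
    -- identify both sides
    have hcombt : (fun x => deriv (fun τ => comb c τ x) 0)
        = fun x => ∑ m, c m * deriv (fun τ => B m τ x) 0 := by
      funext x
      exact (lincomb_data hB c Finset.univ x).2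
    set P : ℝ → ℝ := ladder ι n (fun z => ∑ m ∈ Finset.range (n + 1),
      ch m / m.factorial * (z - 1) ^ m) with hP
    set Q : ℝ → ℝ := ladder ι n (fun z => ∑ m ∈ Finset.range n, cg m / m.factorial * (z - 1) ^ m)
      with hQ
    have hL : N ((P, Q) - dat kf) = Real.sqrt (∫ x in Ioi 1,
        (deriv (fun y => P y - ∑ m, c m * B m 0 y) x ^ 2 + W x * (P x - ∑ m, c m * B m 0 x) ^ 2
          + (Q x - ∑ m, c m * deriv (fun τ => B m τ x) 0) ^ 2)) := by
      show Real.sqrt _ = Real.sqrt _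
      congr 1
      refine setIntegral_congr_fun measurableSet_Ioi fun x _ => ?_
      show deriv (fun y => P y - comb c 0 y) x ^ 2 + W x * (P x - comb c 0 x) ^ 2
          + (Q x - deriv (fun τ => comb c τ x) 0) ^ 2 = _
      rw [congrFun hcombt x]
    rw [hL]
    exact hc
  ------------------------------------------------------------------
  -- apply the abstract lemma
  ------------------------------------------------------------------
  have key := kernel_absorption dat N Λ Adm K D₀ hN0 hNneg hNadd hdat hD₀ hΛ0 hΛK hCst0 hη0 hη18
    (by norm_num : (0 : ℝ) ≤ 1 / 2) (by norm_num : (1 / 2 : ℝ) ≤ 1 / 2) hexact happrox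
  let φX : X := ⟨ψ, (hXmem (φ := ψ)).2 ⟨hψ, hres, hint⟩⟩
  obtain ⟨k, hk, hle⟩ := key φX ε' hε'
  obtain ⟨c, hc⟩ := hKmem.1 hk
  refine ⟨c, ?_, ?_⟩
  · -- integrability of the reduced density: `ψ − comb c` is a far solution
    obtain ⟨dC, dR, dI⟩ := hXmem.1 (φX - k).2
    have : ((φX - k : X) : ℝ → ℝ → ℝ) = fun t x => ψ t x - comb c t x := by
      rw [Submodule.coe_sub, hc]; rfl
    rw [this] at dI
    exact dI
  · -- the bound
    have e : N (dat (φX - k)) ^ 2 = ∫ x in Ioi 1, (deriv (fun τ => ψ τ x - ∑ m, c m * B m τ x) 0 ^ 2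
        + deriv (fun y => ψ 0 y - ∑ m, c m * B m 0 y) x ^ 2
        + W x * (ψ 0 x - ∑ m, c m * B m 0 x) ^ 2) := by
      have hφk : ((φX - k : X) : ℝ → ℝ → ℝ) = fun t x => ψ t x - comb c t x := by
        rw [Submodule.coe_sub, hc]; rfl
      show Real.sqrt _ ^ 2 = _
      rw [Real.sq_sqrt (setIntegral_nonneg measurableSet_Ioi fun x _ => by have := hW0 x; positivity)]
      rw [hdat_apply, hφk]
      exact setIntegral_congr_fun measurableSet_Ioi fun x _ => by simp only [comb]; ring
    rw [← e]
    have : (18 : ℝ) * (8 / c₀) = 144 / c₀ := by ring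
    rw [← this]
    exact hle

end Literature.Analysis.PDE
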